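import Summits.MatrixMultiplication.OmegaCensus.STPPAlignedInvolutionClash
import Literature.Combinatorics.Additive.CriticalTrios

/-!
# ω-census (abelian STPP census): the N18 chain with a PINNED Kneser stabilizer — cosets of the middle set / of `Y°` (kernel, structural lemmas)

HONEST FRAMING (pub-omega census; verbatim): lottery ticket; floor = certified bounds/negative ranges.
Census STRUCTURE (seat pub-omega-stpp-2 gen 31, 2026-08-29), family (b2).  Setting of N18/N19/N20 (`STPPAlignedDoubleKneserFilter.lean`,
`STPPAlignedInvolutionClash.lean`), `C`-reading at block `i` of an STPP family `(A, B, C)` of a finite abelian group `H`: `W = {c − a − b}` (`|W| = vol`),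
`S = −Aᵢ`, `Y° = ⋃_{k≠i}(C_k − B_k)` (`|Y°| = L`), `Z° = ⋃_{k≠i}(C_k − A_k)` (`|Z°| = z`), `V = W ⊔ (S + Y°)`, `Bᵢ + V ⊆ H ∖ Z°`, outer stabilizer
`K = Stab(Bᵢ + V)`, inner stabilizer `K′ = Stab(S + Y°)`; a pair of divisors `(d, d′) = (|K|, |K′|)` is RESCUING when
`z + kLB(bᵢ, vol + kLB(aᵢ, L, d′), d) ≤ |H|` (Kneser twice).  Two structural consequences, the composite-order substitute for Vosper:

* `exists_carrier_middle_subset_coset` — if every rescuing pair has `d = q` and `|H| + q < 2q + z + vol + kLB(aᵢ, L, d′)` for every divisor `d′`, then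
  `|K| = q` and `Bᵢ` lies in ONE coset of the subgroup `K` (Kneser's structure inequality gives `|Bᵢ + K| < 2q`);
* `exists_carrier_DU_subset_coset` — if every rescuing pair has `d′ = q′` and `t + q′ < 2q′ + q′⌈aᵢ/q′⌉` for every `t` with `z + kLB(bᵢ, vol + t, d) ≤ |H|`
  (`d` rescuing), then `|K′| = q′` and `Y°` lies in ONE coset of `K′` — hence so does every `B_k` (`k ≠ i`).

The subgroups are delivered as `IsSubgroupCarrier` finsets (`Literature.Combinatorics.Additive.CriticalTrios`).  Cross-reading CLASHES built on them
(two readings pin the same small set into cosets of two subgroups that are equal / meet trivially) are in `STPPCrossReadingCosetClashZ35.lean`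
(order 35).  Nothing here is progress on `ω`.

References: M. Kneser, Math. Z. 58 (1953); H. Cohn, R. Kleinberg, B. Szegedy, C. Umans, FOCS 2005 (arXiv:math/0511460), Def. 5.1.
-/

open Finset
open scoped Pointwise

namespace Summit.MatrixMultiplication.OmegaCensus.CubeNB

open Literature.Computability.AlgebraicComplexity
open Literature.Combinatorics.Additive
open Summit.MatrixMultiplication.OmegaCensus.STPPKneser

variable {H : Type*} [AddCommGroup H] [DecidableEq H] [Fintype H] {N : ℕ} {A B C : Fin N → Finset H}

/-! ## §1 Subgroup carriers: cosets, intersections of coprime / equal prime orders -/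

section Carrier

omit [Fintype H] in
/-- A set inside `A + K` (`K` a subgroup carrier) meeting a coset of `K` only inside that coset: if `#(Bᵢ + K) < 2 #K` then `Bᵢ` lies in one coset.
[folklore] -/
theorem subset_coset_of_card_add_lt {K S : Finset H} (hK : IsSubgroupCarrier K) {b : H} (hb : b ∈ S)
    (hlt : #(S + K) < 2 * #K) : S ⊆ b +ᵥ K := by
  intro x hx
  by_contra hxb
  have hdisj : Disjoint (b +ᵥ K) (x +ᵥ K) := by
    rcases hK.coset_eq_or_disjoint b x with h | h
    · exact absurd (h ▸ hK.mem_coset_self x) hxb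
    · exact h
  have hsub : (b +ᵥ K) ∪ (x +ᵥ K) ⊆ S + K := by
    refine Finset.union_subset ?_ ?_
    · intro y hy
      obtain ⟨k, hk, rfl⟩ := Finset.mem_vadd_finset.1 hy
      exact Finset.add_mem_add hb hk
    · intro y hy
      obtain ⟨k, hk, rfl⟩ := Finset.mem_vadd_finset.1 hy
      exact Finset.add_mem_add hx hk
  have h2 : #((b +ᵥ K) ∪ (x +ᵥ K)) = 2 * #K := by
    rw [Finset.card_union_of_disjoint hdisj, Finset.card_vadd_finset, Finset.card_vadd_finset]; ring
  have := Finset.card_le_card hsub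
  omega

omit [Fintype H] in
/-- Two cosets of subgroup carriers meeting trivially share at most one point: a set inside both has at most one element. [folklore] -/
theorem card_le_one_of_subset_cosets {K K' S : Finset H} (hK : IsSubgroupCarrier K) (hK' : IsSubgroupCarrier K')
    (hKK : K ∩ K' = {0}) {b b' : H} (h1 : S ⊆ b +ᵥ K) (h2 : S ⊆ b' +ᵥ K') : #S ≤ 1 := by
  refine Finset.card_le_one.2 fun x hx y hy => ?_
  have hx1 := (hK.mem_coset_iff).1 (h1 hx)
  have hy1 := (hK.mem_coset_iff).1 (h1 hy)
  have hx2 := (hK'.mem_coset_iff).1 (h2 hx)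
  have hy2 := (hK'.mem_coset_iff).1 (h2 hy)
  have hK1 : x - y ∈ K := by
    have := hK.sub_mem hx1 hy1; rwa [sub_sub_sub_cancel_right] at this
  have hK2 : x - y ∈ K' := by
    have := hK'.sub_mem hx2 hy2; rwa [sub_sub_sub_cancel_right] at this
  have : x - y ∈ K ∩ K' := Finset.mem_inter.2 ⟨hK1, hK2⟩
  rw [hKK, Finset.mem_singleton] at this
  exact sub_eq_zero.1 this

omit [Fintype H] in
/-- Subgroup carriers of coprime orders meet in `{0}`. [folklore] -/
theorem inter_eq_zero_of_coprime {K K' : Finset H} (hK : IsSubgroupCarrier K) (hK' : IsSubgroupCarrier K')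
    (hcop : Nat.Coprime #K #K') : K ∩ K' = {0} := by
  have hI := hK.inter hK'
  have h1 : #(K ∩ K') ∣ #K := IsSubgroupCarrier.card_dvd_of_subset hI hK Finset.inter_subset_left
  have h2 : #(K ∩ K') ∣ #K' := IsSubgroupCarrier.card_dvd_of_subset hI hK' Finset.inter_subset_right
  have h3 : #(K ∩ K') = 1 := Nat.eq_one_of_dvd_coprimes hcop h1 h2
  obtain ⟨x, hx⟩ := Finset.card_eq_one.1 h3
  have h0 : (0 : H) ∈ K ∩ K' := Finset.mem_inter.2 ⟨hK.zero_mem, hK'.zero_mem⟩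
  rw [hx, Finset.mem_singleton] at h0
  rw [hx, h0]

/-- Two subgroup carriers of the same PRIME order `q` with `q² ∤ |H|` coincide (Lagrange for `K + K′`). [folklore] -/
theorem eq_of_card_eq_prime {K K' : Finset H} (hK : IsSubgroupCarrier K) (hK' : IsSubgroupCarrier K') {q : ℕ} (hq : q.Prime)
    (hKq : #K = q) (hK'q : #K' = q) (hn : ¬ q * q ∣ Fintype.card H) : K = K' := by
  have hI := hK.inter hK'
  have h1 : #(K ∩ K') ∣ q := hKq ▸ IsSubgroupCarrier.card_dvd_of_subset hI hK Finset.inter_subset_left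
  rcases (Nat.dvd_prime hq).1 h1 with h | h
  · -- trivial intersection: K + K' is a subgroup carrier of order q², contradiction
    exfalso
    have hsum : IsSubgroupCarrier (K + K') := by
      refine ⟨Finset.add_mem_add hK.zero_mem hK'.zero_mem |> (by simpa using ·), ?_⟩
      intro x hx y hy
      obtain ⟨x1, hx1, x2, hx2, rfl⟩ := Finset.mem_add.1 hx
      obtain ⟨y1, hy1, y2, hy2, rfl⟩ := Finset.mem_add.1 hy
      have : x1 + x2 - (y1 + y2) = (x1 - y1) + (x2 - y2) := by abel
      rw [this]
      exact Finset.add_mem_add (hK.sub_mem hx1 hy1) (hK'.sub_mem hx2 hy2)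
    have hinj : Set.InjOn (fun p : H × H => p.1 + p.2) ↑(K ×ˢ K') := by
      rintro ⟨x1, x2⟩ hx ⟨y1, y2⟩ hy (hxy : x1 + x2 = y1 + y2)
      simp only [Finset.coe_product, Set.mem_prod, Finset.mem_coe] at hx hy
      have hd : x1 - y1 = y2 - x2 := by
        have := hxy; rw [← sub_eq_zero] at this ⊢; rw [← this]; abel
      have hmem : x1 - y1 ∈ K ∩ K' := Finset.mem_inter.2 ⟨hK.sub_mem hx.1 hy.1, hd ▸ hK'.sub_mem hy.2 hx.2⟩
      obtain ⟨w, hw⟩ := Finset.card_eq_one.1 h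
      have h0 : (0 : H) ∈ K ∩ K' := Finset.mem_inter.2 ⟨hK.zero_mem, hK'.zero_mem⟩
      rw [hw, Finset.mem_singleton] at hmem h0
      rw [← h0] at hmem
      have e1 : x1 = y1 := sub_eq_zero.1 hmem
      have e2 : x2 = y2 := by rw [e1] at hxy; exact add_left_cancel hxy
      rw [e1, e2]
    have hcard : #(K + K') = q * q := by
      rw [← Finset.image_add_product, Finset.card_image_of_injOn hinj, Finset.card_product, hKq, hK'q]
    have huniv : IsSubgroupCarrier (Finset.univ : Finset H) := ⟨Finset.mem_univ _, fun _ _ _ _ => Finset.mem_univ _⟩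
    have hdvd := IsSubgroupCarrier.card_dvd_of_subset hsum huniv (Finset.subset_univ _)
    rw [hcard, Finset.card_univ] at hdvd
    exact hn hdvd
  · -- K ∩ K' = K: K ⊆ K', same size
    have hsub : K ⊆ K' := by
      have : K ∩ K' = K := Finset.eq_of_subset_of_card_le Finset.inter_subset_left (by rw [h, hKq])
      rw [← this]; exact Finset.inter_subset_right
    exact Finset.eq_of_subset_of_card_le hsub (by rw [hKq, hK'q])

end Carrier

/-! ## §2 The N18 chain with a pinned stabilizer -/

section Pinned

/-- **Outer stabilizer pinned ⇒ the middle set lies in one coset.**  `C`-reading at block `i` (notation of the module docstring): if every rescuing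
pair `(d, d′)` has `d = q`, and `|H| + q < 2q + z + vol + kLB(aᵢ, L, d′)` for every divisor `d′` of `|H|`, then there is a subgroup carrier `K` with
`#K = q` and `Bᵢ ⊆ b + K`. [cite: Kneser1953] [cite: CohnKleinbergSzegedyUmans2005, Def. 5.1] -/
theorem exists_carrier_middle_subset_coset (hS : IsSTPP A B C) (hA : ∀ i, (A i).Nonempty) (hB : ∀ i, (B i).Nonempty)
    (hC : ∀ i, (C i).Nonempty) (i : Fin N) (hI : (univ.erase i : Finset (Fin N)).Nonempty) {q : ℕ}
    (h1 : ∀ d d' : ℕ, 0 < d → d ∣ Fintype.card H → 0 < d' → d' ∣ Fintype.card H →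
      ∑ k ∈ univ.erase i, #(A k) * #(C k) +
        kneserLB #(B i) (#(A i) * #(B i) * #(C i) + kneserLB #(A i) (∑ k ∈ univ.erase i, #(B k) * #(C k)) d') d ≤
          Fintype.card H → d = q)
    (h3 : ∀ d' : ℕ, 0 < d' → d' ∣ Fintype.card H →
      Fintype.card H + q < 2 * q + ∑ k ∈ univ.erase i, #(A k) * #(C k) + #(A i) * #(B i) * #(C i) +
        kneserLB #(A i) (∑ k ∈ univ.erase i, #(B k) * #(C k)) d') :
    ∃ K : Finset H, IsSubgroupCarrier K ∧ #K = q ∧ ∃ b ∈ B i, B i ⊆ b +ᵥ K := by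
  -- the sets
  set W := ((A i) ×ˢ ((B i) ×ˢ (C i))).image fun t : H × H × H => (0 : H) + t.2.2 - t.1 - t.2.1 with hW
  set S := (A i).image (fun a => (0 : H) - a) with hSdef
  set Yo := DU B C (univ.erase i) with hYo
  set Zo := DU A C (univ.erase i) with hZo
  set V := W ∪ (S + Yo) with hV
  have hWcard : #W = #(A i) * #(B i) * #(C i) := card_image_blockSum hS i 0
  have hScard : #S = #(A i) := Finset.card_image_of_injective _ (sub_right_injective)
  have hYcard : #Yo = ∑ k ∈ univ.erase i, #(B k) * #(C k) := card_DU_BC hS hA _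
  have hZcard : #Zo = ∑ k ∈ univ.erase i, #(A k) * #(C k) := card_DU_AC hS hB _
  have hSne : S.Nonempty := (hA i).image _
  have hYne : Yo.Nonempty := DU_nonempty hI hB hC
  have hSYne : (S + Yo).Nonempty := hSne.add hYne
  have hWV : Disjoint W (S + Yo) := disjoint_W_negA_add_DU hS i
  have hVcard : #V = #W + #(S + Yo) := Finset.card_union_of_disjoint hWV
  have hVne : V.Nonempty := hSYne.mono Finset.subset_union_right
  have hBVne : (B i + V).Nonempty := (hB i).add hVne
  -- the inclusion Bᵢ + V ⊆ H ∖ Z°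
  have hU : #(univ \ Zo) = Fintype.card H - #Zo := by
    rw [Finset.card_sdiff_of_subset (Finset.subset_univ _), Finset.card_univ]
  have hZle : #Zo ≤ Fintype.card H := Finset.card_le_univ _
  have hsub0 := Finset.card_le_card (B_add_W_union_negA_add_subset hS i)
  rw [hU] at hsub0
  have hsub : #(B i + V) ≤ Fintype.card H - #Zo := hsub0
  -- the two stabilizers
  set K := (B i + V).addStab with hK
  set K' := (S + Yo).addStab with hK'
  have hKne : K.Nonempty := hBVne.addStab
  have hK'ne : K'.Nonempty := hSYne.addStab
  have hKdvd : #K ∣ Fintype.card H := hBVne.card_addStab_dvd_card_univ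
  have hK'dvd : #K' ∣ Fintype.card H := hSYne.card_addStab_dvd_card_univ
  -- Kneser with the true stabilizers
  have hkK' : kneserLB #S #Yo #K' ≤ #(S + Yo) := kneserLB_card_addStab_le S Yo hSne hYne
  have hkK : kneserLB #(B i) #V #K ≤ #(B i + V) := kneserLB_card_addStab_le (B i) V (hB i) hVne
  have hVge : #(A i) * #(B i) * #(C i) + kneserLB #(A i) (∑ k ∈ univ.erase i, #(B k) * #(C k)) #K' ≤ #V := by
    rw [hVcard, hWcard, ← hScard, ← hYcard]; omega
  have hmono := kneserLB_mono_right #(B i) #K hVge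
  -- (|K|, |K'|) is a rescuing pair, hence |K| = q
  have hKq : #K = q := h1 #K #K' hKne.card_pos hKdvd hK'ne.card_pos hK'dvd (by rw [← hZcard]; omega)
  -- structural Kneser inequality for (Bᵢ, V): |Bᵢ + K| + |V + K| ≤ |Bᵢ + V| + |K|
  have hknB := Literature.Combinatorics.Additive.add_kneser (B i) V
  rw [← hK] at hknB
  have hVK : #V ≤ #(V + K) := card_le_card_add_right hKne
  have h3' := h3 #K' hK'ne.card_pos hK'dvd
  have hBlt : #(B i + K) < 2 * q := by
    rw [hScard, hYcard] at hkK'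
    rw [← hZcard, ← hWcard] at h3'
    rw [hKq] at hknB
    omega
  obtain ⟨b, hb⟩ := hB i
  have hKc : IsSubgroupCarrier K := IsSubgroupCarrier.of_addStab hBVne
  exact ⟨K, hKc, hKq, b, hb, subset_coset_of_card_add_lt hKc hb (hKq.symm ▸ hBlt)⟩

/-- **Inner stabilizer pinned ⇒ `Y°` lies in one coset.**  `C`-reading at block `i`: if every rescuing pair `(d, d′)` has `d′ = q′`, and
`t + q′ < 2q′ + q′·⌈aᵢ/q′⌉` for every `t ≤ |H|` and divisor `d` with `z + kLB(bᵢ, vol + t, d) ≤ |H|`, then there is a subgroup carrier `K′` with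
`#K′ = q′` and `Y° = ⋃_{k≠i}(C_k − B_k) ⊆ y + K′`; in particular every `B_k` (`k ≠ i`) lies in one coset of `K′`.
[cite: Kneser1953] [cite: CohnKleinbergSzegedyUmans2005, Def. 5.1] -/
theorem exists_carrier_DU_subset_coset (hS : IsSTPP A B C) (hA : ∀ i, (A i).Nonempty) (hB : ∀ i, (B i).Nonempty)
    (hC : ∀ i, (C i).Nonempty) (i : Fin N) (hI : (univ.erase i : Finset (Fin N)).Nonempty) {q' : ℕ}
    (h1 : ∀ d d' : ℕ, 0 < d → d ∣ Fintype.card H → 0 < d' → d' ∣ Fintype.card H →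
      ∑ k ∈ univ.erase i, #(A k) * #(C k) +
        kneserLB #(B i) (#(A i) * #(B i) * #(C i) + kneserLB #(A i) (∑ k ∈ univ.erase i, #(B k) * #(C k)) d') d ≤
          Fintype.card H → d' = q')
    (h2 : ∀ d t : ℕ, 0 < d → d ∣ Fintype.card H → t ≤ Fintype.card H →
      ∑ k ∈ univ.erase i, #(A k) * #(C k) + kneserLB #(B i) (#(A i) * #(B i) * #(C i) + t) d ≤ Fintype.card H →
        t + q' < 2 * q' + (#(A i) + q' - 1) / q' * q') :
    ∃ K' : Finset H, IsSubgroupCarrier K' ∧ #K' = q' ∧ ∃ y : H, DU B C (univ.erase i) ⊆ y +ᵥ K' := by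
  -- the sets
  set W := ((A i) ×ˢ ((B i) ×ˢ (C i))).image fun t : H × H × H => (0 : H) + t.2.2 - t.1 - t.2.1 with hW
  set S := (A i).image (fun a => (0 : H) - a) with hSdef
  set Yo := DU B C (univ.erase i) with hYo
  set Zo := DU A C (univ.erase i) with hZo
  set V := W ∪ (S + Yo) with hV
  have hWcard : #W = #(A i) * #(B i) * #(C i) := card_image_blockSum hS i 0
  have hScard : #S = #(A i) := Finset.card_image_of_injective _ (sub_right_injective)
  have hYcard : #Yo = ∑ k ∈ univ.erase i, #(B k) * #(C k) := card_DU_BC hS hA _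
  have hZcard : #Zo = ∑ k ∈ univ.erase i, #(A k) * #(C k) := card_DU_AC hS hB _
  have hSne : S.Nonempty := (hA i).image _
  have hYne : Yo.Nonempty := DU_nonempty hI hB hC
  have hSYne : (S + Yo).Nonempty := hSne.add hYne
  have hWV : Disjoint W (S + Yo) := disjoint_W_negA_add_DU hS i
  have hVcard : #V = #W + #(S + Yo) := Finset.card_union_of_disjoint hWV
  have hVne : V.Nonempty := hSYne.mono Finset.subset_union_right
  have hBVne : (B i + V).Nonempty := (hB i).add hVne
  have hU : #(univ \ Zo) = Fintype.card H - #Zo := by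
    rw [Finset.card_sdiff_of_subset (Finset.subset_univ _), Finset.card_univ]
  have hZle : #Zo ≤ Fintype.card H := Finset.card_le_univ _
  have hsub0 := Finset.card_le_card (B_add_W_union_negA_add_subset hS i)
  rw [hU] at hsub0
  have hsub : #(B i + V) ≤ Fintype.card H - #Zo := hsub0
  set K := (B i + V).addStab with hK
  set K' := (S + Yo).addStab with hK'
  have hKne : K.Nonempty := hBVne.addStab
  have hK'ne : K'.Nonempty := hSYne.addStab
  have hKdvd : #K ∣ Fintype.card H := hBVne.card_addStab_dvd_card_univ
  have hK'dvd : #K' ∣ Fintype.card H := hSYne.card_addStab_dvd_card_univ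
  have hkK' : kneserLB #S #Yo #K' ≤ #(S + Yo) := kneserLB_card_addStab_le S Yo hSne hYne
  have hkK : kneserLB #(B i) #V #K ≤ #(B i + V) := kneserLB_card_addStab_le (B i) V (hB i) hVne
  have hVge : #(A i) * #(B i) * #(C i) + kneserLB #(A i) (∑ k ∈ univ.erase i, #(B k) * #(C k)) #K' ≤ #V := by
    rw [hVcard, hWcard, ← hScard, ← hYcard]; omega
  have hmono := kneserLB_mono_right #(B i) #K hVge
  -- (|K|, |K'|) is rescuing, hence |K'| = q'
  have hK'q : #K' = q' := h1 #K #K' hKne.card_pos hKdvd hK'ne.card_pos hK'dvd (by rw [← hZcard]; omega)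
  -- the inner size t = |S + Y°| satisfies the outer constraint with d = |K|
  have hSYle : #(S + Yo) ≤ Fintype.card H := Finset.card_le_univ _
  have ht := h2 #K #(S + Yo) hKne.card_pos hKdvd hSYle (by rw [← hZcard, ← hWcard, ← hVcard]; omega)
  -- structural Kneser for (S, Y°): |S + K'| + |Y° + K'| ≤ |S + Y°| + |K'|
  have hknS := Literature.Combinatorics.Additive.add_kneser S Yo
  rw [← hK'] at hknS
  have hK'c : IsSubgroupCarrier K' := IsSubgroupCarrier.of_addStab hSYne
  -- |S + K'| is a positive multiple of q' and ≥ |S| = aᵢ, so ≥ q'⌈aᵢ/q'⌉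
  have hSK : (#(A i) + q' - 1) / q' * q' ≤ #(S + K') := by
    have hstab : S + K' + K' = S + K' := hK'c.add_add_self S
    have hdv : #K' ∣ #(S + K') := hK'c.card_dvd_of_stable hstab
    rw [hK'q] at hdv
    have hge : #S ≤ #(S + K') := card_le_card_add_right hK'ne
    rw [hScard] at hge
    obtain ⟨m, hm⟩ := hdv
    rw [hm]
    have hq0 : 0 < q' := hK'q ▸ hK'ne.card_pos
    have : (#(A i) + q' - 1) / q' ≤ m := by
      rw [Nat.div_le_iff_le_mul_add_pred hq0]
      rw [hm] at hge
      have : (#(A i) + q' - 1) ≤ q' * m + (q' - 1) := by omega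
      simpa [Nat.mul_comm] using this
    calc (#(A i) + q' - 1) / q' * q' ≤ m * q' := Nat.mul_le_mul_right _ this
      _ = q' * m := Nat.mul_comm _ _
  have hYlt : #(Yo + K') < 2 * q' := by
    rw [hK'q] at hknS
    omega
  obtain ⟨y, hy⟩ := hYne
  exact ⟨K', hK'c, hK'q, y, subset_coset_of_card_add_lt hK'c hy (hK'q.symm ▸ hYlt)⟩

omit [Fintype H] in
/-- From `⋃_{k≠i}(C_k − B_k) ⊆ y + K′`: each `B_k` (`k ≠ i`) lies in one coset of `K′`. [folklore] -/
theorem block_subset_coset_of_DU_subset {K' : Finset H} (hK' : IsSubgroupCarrier K') {i k : Fin N} (hk : k ≠ i) {y : H}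
    (h : DU B C (univ.erase i) ⊆ y +ᵥ K') {c : H} (hc : c ∈ C k) : B k ⊆ (c - y) +ᵥ K' := by
  intro b hb
  have hmem : c - b ∈ DU B C (univ.erase i) := by
    refine Finset.mem_biUnion.2 ⟨k, Finset.mem_erase.2 ⟨hk, Finset.mem_univ _⟩, ?_⟩
    exact mem_D.2 ⟨b, hb, c, hc, rfl⟩
  have h1 := (hK'.mem_coset_iff).1 (h hmem)
  rw [hK'.mem_coset_iff]
  have : b - (c - y) = -(c - b - y) := by abel
  rw [this]
  exact hK'.neg_mem h1

end Pinned

/-! ## §3 Decidable card-vector side conditions and the literal-size front ends -/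

section Front

/-- Side conditions of `exists_carrier_middle_subset_coset` on the numbers `(n, q, z, b, vol, a, L)` (outer stabilizer pinned to order `q`). [folklore] -/
def OutPinned (n q z b vol a L : ℕ) : Bool :=
  decide ((∀ d ∈ Nat.divisors n, ∀ d' ∈ Nat.divisors n, n < z + kneserLB b (vol + kneserLB a L d') d ∨ d = q) ∧
    (∀ d' ∈ Nat.divisors n, n + q < 2 * q + z + vol + kneserLB a L d'))

/-- Side conditions of `exists_carrier_DU_subset_coset` on the numbers `(n, q′, z, b, vol, a, L)` (inner stabilizer pinned to order `q′`). [folklore] -/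
def InPinned (n q' z b vol a L : ℕ) : Bool :=
  decide ((∀ d ∈ Nat.divisors n, ∀ d' ∈ Nat.divisors n, n < z + kneserLB b (vol + kneserLB a L d') d ∨ d' = q') ∧
    (∀ d ∈ Nat.divisors n, ∀ t < n + 1, z + kneserLB b (vol + t) d ≤ n → t + q' < 2 * q' + (a + q' - 1) / q' * q'))

/-- `exists_carrier_middle_subset_coset` with literal sizes and the side conditions decided by `OutPinned`. [cite: Kneser1953] [cite: CohnKleinbergSzegedyUmans2005, Def. 5.1] -/
theorem exists_carrier_middle_subset_coset' (hS : IsSTPP A B C) (hA : ∀ i, (A i).Nonempty) (hB : ∀ i, (B i).Nonempty)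
    (hC : ∀ i, (C i).Nonempty) (i : Fin N) (hI : (univ.erase i : Finset (Fin N)).Nonempty) {n q z b vol a L : ℕ}
    (hn : Fintype.card H = n) (ha : #(A i) = a) (hb : #(B i) = b) (hvol : #(A i) * #(B i) * #(C i) = vol)
    (hz : ∑ k ∈ univ.erase i, #(A k) * #(C k) = z) (hL : ∑ k ∈ univ.erase i, #(B k) * #(C k) = L)
    (h : OutPinned n q z b vol a L = true) :
    ∃ K : Finset H, IsSubgroupCarrier K ∧ #K = q ∧ ∃ b₀ ∈ B i, B i ⊆ b₀ +ᵥ K := by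
  obtain ⟨h1, h3⟩ := of_decide_eq_true h
  have hn0 : n ≠ 0 := by rw [← hn]; exact Fintype.card_ne_zero
  refine exists_carrier_middle_subset_coset hS hA hB hC i hI ?_ ?_
  · intro d d' hd hdd hd' hdd' hle
    rw [hn] at hdd hdd' hle
    rw [hvol, ha, hb, hz, hL] at hle
    rcases h1 d (Nat.mem_divisors.2 ⟨hdd, hn0⟩) d' (Nat.mem_divisors.2 ⟨hdd', hn0⟩) with h' | h'
    · omega
    · exact h'
  · intro d' hd' hdd'
    rw [hn] at hdd' ⊢
    rw [hvol, ha, hz, hL]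
    exact h3 d' (Nat.mem_divisors.2 ⟨hdd', hn0⟩)

/-- `exists_carrier_DU_subset_coset` with literal sizes and the side conditions decided by `InPinned`. [cite: Kneser1953] [cite: CohnKleinbergSzegedyUmans2005, Def. 5.1] -/
theorem exists_carrier_DU_subset_coset' (hS : IsSTPP A B C) (hA : ∀ i, (A i).Nonempty) (hB : ∀ i, (B i).Nonempty)
    (hC : ∀ i, (C i).Nonempty) (i : Fin N) (hI : (univ.erase i : Finset (Fin N)).Nonempty) {n q' z b vol a L : ℕ}
    (hn : Fintype.card H = n) (ha : #(A i) = a) (hb : #(B i) = b) (hvol : #(A i) * #(B i) * #(C i) = vol)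
    (hz : ∑ k ∈ univ.erase i, #(A k) * #(C k) = z) (hL : ∑ k ∈ univ.erase i, #(B k) * #(C k) = L)
    (h : InPinned n q' z b vol a L = true) :
    ∃ K' : Finset H, IsSubgroupCarrier K' ∧ #K' = q' ∧ ∃ y : H, DU B C (univ.erase i) ⊆ y +ᵥ K' := by
  obtain ⟨h1, h2⟩ := of_decide_eq_true h
  have hn0 : n ≠ 0 := by rw [← hn]; exact Fintype.card_ne_zero
  refine exists_carrier_DU_subset_coset hS hA hB hC i hI ?_ ?_
  · intro d d' hd hdd hd' hdd' hle
    rw [hn] at hdd hdd' hle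
    rw [hvol, ha, hb, hz, hL] at hle
    rcases h1 d (Nat.mem_divisors.2 ⟨hdd, hn0⟩) d' (Nat.mem_divisors.2 ⟨hdd', hn0⟩) with h' | h'
    · omega
    · exact h'
  · intro d t hd hdd ht hle
    rw [hn] at hdd ht hle
    rw [hvol, hb, hz] at hle
    rw [ha]
    exact h2 d (Nat.mem_divisors.2 ⟨hdd, hn0⟩) t (by omega) hle

end Front

end Summit.MatrixMultiplication.OmegaCensus.CubeNB
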